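import Mathlib
import HarnessLib
import Summits.ValiantsHypothesis.ValiantsHypothesis.Theorems.LacunarySymmetroidMatrixDescartesProductPlusOneRiccati

/-!
# LINE (A) `product_plus_one` — letter-partial sums, EVERY support size K and every coupling (AB0 / AB1 in all formats)

Crux item stmt-ValiantsHypothesis-18050, LINE (A) floor structure (registered floor stub `OneChangeFloorK3`).  The K = 3 letter-sum chart at
the bottom coupling (AB0–AB3, type-β count) is val-lit-p5 g14's ✓ `…ProductPlusOneABWindow`; this file carries only the ALL-K bookkeeping the
LINE owner (val-idea-25 g3, ruling 23:35Z 2026-08-28) asked for next to it.  Rows `a : Fin m → Fin K → ℝ`, support `d : Fin K → ℕ`, factors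
`f_j = Σ_l a_{jl} X^{d_l}`, coupling `l₀`; letter-partial sums `S_l = Σ_j a_{jl} ∏_{i≠j} f_i` and, off the poles, `A_l(x) = Σ_j a_{jl}/f_j(x)`.

* `eulerNumerator_eq_letterSums` (AB0, polynomial identity): `R = Σ_l (d_l − d_{l₀})·X^{d_l}·S_l`;
* `eval_eulerNumerator_eq_prod_mul_letterSumsK`: at a point where no factor vanishes, `R(x) = ∏_j f_j(x) · Σ_l (d_l − d_{l₀}) x^{d_l} A_l(x)`;
* `letterTermK_hasDerivAt`, `letterTermK_deriv_sign`, ★ `letterSumK_antitoneOn` (AB1, every K): for rows whose NON-BOTTOM letters are weakly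
  one-signed (`(a_{jl})_{l ≥ 1}` all `≥ 0` or all `≤ 0`, bottom letter free) every stripped letter sum `x ↦ Σ_j a_{jl}/g_j(x)` with `l ≥ 1`,
  `g_j(x) = Σ_l a_{jl} x^{d_l − d_0}`, is antitone on each pole-free interval of `(0, ∞)` — no ratio condition, any K;
* `eulerNumerator_eval_ne_zero_of_letterSumsK` (every K, bottom coupling, `StrictMono d`): if at a pole-free `x > 0` all stripped letter sums
  `A_l`, `l ≥ 1`, are `> 0` (or all `< 0`) then `R(x) ≠ 0` — zeros need two letter sums of opposite sign.

Honest framing: bookkeeping and one monotonicity fact; nothing here counts zeros in a window; NOT `OneChangeFloorK3` / `stub_classRowK3` /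
`stub_polyLaw` / `MatrixDescartes` / B; `VP ≠ VNP` NOT proved.  No definitions, no named facts; Mathlib only.
-/

set_option linter.dupNamespace false

namespace Summit.ValiantsHypothesis.ValiantsHypothesis.Theorems.LacunarySymmetroidMatrixDescartes

namespace ProductPlusOne

open Finset Polynomial
open scoped BigOperators Polynomial

/-! ### §1 AB0 in all formats -/

/-- **AB0** (every `K`, every coupling `l₀`): `R = Σ_l (d_l − d_{l₀})·X^{d_l}·(Σ_j a_{jl} ∏_{i≠j} f_i)`. [ring bookkeeping] -/
theorem eulerNumerator_eq_letterSums {m K : ℕ} (d : Fin K → ℕ) (a : Fin m → Fin K → ℝ) (l₀ : Fin K) :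
    (∑ j, (∑ l, C (a j l * ((d l : ℝ) - d l₀)) * X ^ (d l)) * ∏ i ∈ Finset.univ.erase j, (∑ l, C (a i l) * X ^ (d l)) : ℝ[X])
      = ∑ l, C ((d l : ℝ) - d l₀) * X ^ (d l)
          * ∑ j, C (a j l) * ∏ i ∈ Finset.univ.erase j, (∑ l', C (a i l') * X ^ (d l')) := by
  simp only [Finset.sum_mul, Finset.mul_sum, C_mul]
  rw [Finset.sum_comm]
  refine Finset.sum_congr rfl fun l _ => Finset.sum_congr rfl fun j _ => by ring

/-- **AB0 evaluated** (every `K`, every coupling): where no factor vanishes, `R(x) = ∏_j f_j(x) · Σ_l (d_l − d_{l₀})·x^{d_l}·Σ_j a_{jl}/f_j(x)`. -/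
theorem eval_eulerNumerator_eq_prod_mul_letterSumsK {m K : ℕ} (d : Fin K → ℕ) (a : Fin m → Fin K → ℝ) (l₀ : Fin K) {x : ℝ}
    (hf : ∀ j, (∑ l, C (a j l) * X ^ (d l) : ℝ[X]).eval x ≠ 0) :
    (∑ j, (∑ l, C (a j l * ((d l : ℝ) - d l₀)) * X ^ (d l)) * ∏ i ∈ Finset.univ.erase j, (∑ l, C (a i l) * X ^ (d l))
        : ℝ[X]).eval x
      = (∏ j, (∑ l, C (a j l) * X ^ (d l) : ℝ[X]).eval x)
          * ∑ l, ((d l : ℝ) - d l₀) * x ^ (d l) * ∑ j, a j l / (∑ l', C (a j l') * X ^ (d l') : ℝ[X]).eval x := by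
  classical
  rw [eulerNumerator_eq_letterSums, eval_finsetSum, Finset.mul_sum]
  refine Finset.sum_congr rfl fun l _ => ?_
  rw [eval_mul, eval_mul, eval_C, eval_pow, eval_X, eval_finsetSum, Finset.mul_sum, Finset.mul_sum, Finset.mul_sum]
  refine Finset.sum_congr rfl fun j _ => ?_
  rw [eval_mul, eval_C, eval_prod]
  have hP : (∏ i ∈ Finset.univ.erase j, (∑ l', C (a i l') * X ^ (d l') : ℝ[X]).eval x)
      = (∏ i, (∑ l', C (a i l') * X ^ (d l') : ℝ[X]).eval x) / (∑ l', C (a j l') * X ^ (d l') : ℝ[X]).eval x := by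
    have hmp := Finset.mul_prod_erase Finset.univ (fun i => (∑ l', C (a i l') * X ^ (d l') : ℝ[X]).eval x) (Finset.mem_univ j)
    rw [eq_div_iff (hf j), mul_comm]
    exact hmp
  rw [hP]
  ring

/-! ### §2 AB1 in all formats: the stripped letter sums of an upper-signed company are antitone -/

/-- Derivative of one stripped letter term `al/g(x)`, `g(x) = Σ_l a_l x^{e_l}`, where `g(x) ≠ 0`. -/
theorem letterTermK_hasDerivAt {K : ℕ} (e : Fin K → ℕ) (b : Fin K → ℝ) (al : ℝ) {x : ℝ} (hg : ∑ l, b l * x ^ (e l) ≠ 0) :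
    HasDerivAt (fun t : ℝ => al / ∑ l, b l * t ^ (e l))
      (-(al * ∑ l, b l * ((e l : ℝ) * x ^ (e l - 1))) / (∑ l, b l * x ^ (e l)) ^ 2) x := by
  have hg' : HasDerivAt (fun t : ℝ => ∑ l, b l * t ^ (e l)) (∑ l, b l * ((e l : ℝ) * x ^ (e l - 1))) x :=
    HasDerivAt.fun_sum (u := Finset.univ) fun l _ => (hasDerivAt_pow (e l) x).const_mul (b l)
  have h := (hasDerivAt_const x al).div hg' hg
  refine h.congr_deriv ?_
  ring

/-- Sign of a stripped letter term's derivative for an upper-signed row: exponents `e` with `e l = 0` exactly at the bottom index `l = i₀`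
is not needed — it suffices that the bottom exponent is `0`; then `al·(x g′(x)) ≥ 0` for `al` one of the non-bottom letters, `x > 0`. -/
theorem letterTermK_deriv_sign {K : ℕ} (e : Fin K → ℕ) (b : Fin K → ℝ) (i₀ : Fin K) (he : e i₀ = 0)
    (hus : (∀ l, l ≠ i₀ → 0 ≤ b l) ∨ (∀ l, l ≠ i₀ → b l ≤ 0)) (al : ℝ) (hl : ∃ l, l ≠ i₀ ∧ al = b l) {x : ℝ} (hx : 0 < x) :
    0 ≤ al * ∑ l, b l * ((e l : ℝ) * x ^ (e l - 1)) := by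
  rw [Finset.mul_sum]
  refine Finset.sum_nonneg fun l _ => ?_
  by_cases hli : l = i₀
  · subst hli; rw [he]; simp
  · obtain ⟨l₁, hl₁, rfl⟩ := hl
    have hprod : 0 ≤ b l₁ * b l := by
      rcases hus with h | h
      · exact mul_nonneg (h l₁ hl₁) (h l hli)
      · exact mul_nonneg_of_nonpos_of_nonpos (h l₁ hl₁) (h l hli)
    have hx' : 0 ≤ (e l : ℝ) * x ^ (e l - 1) := by positivity
    calc (0 : ℝ) ≤ (b l₁ * b l) * ((e l : ℝ) * x ^ (e l - 1)) := mul_nonneg hprod hx'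
      _ = b l₁ * (b l * ((e l : ℝ) * x ^ (e l - 1))) := by ring

/-- ★ **AB1, every K — stripped letter sums of an upper-signed company are antitone on pole-free intervals.**  Exponents `e : Fin K → ℕ`
with `e i₀ = 0` (the stripped support `e_l = d_l − d_0`, `i₀` the bottom index); rows `b j` whose letters off `i₀` are weakly one-signed; a
letter choice `al j = b j l_j` with `l_j ≠ i₀`; `[lo, hi] ⊂ (0, ∞)` on which no `g_j(x) = Σ_l b_{jl} x^{e_l}` vanishes.  Then
`x ↦ Σ_j al_j/g_j(x)` is antitone on `[lo, hi]`. [this file's theorem] -/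
theorem letterSumK_antitoneOn {m K : ℕ} (e : Fin K → ℕ) (i₀ : Fin K) (he : e i₀ = 0) (b : Fin m → Fin K → ℝ)
    (hus : ∀ j, (∀ l, l ≠ i₀ → 0 ≤ b j l) ∨ (∀ l, l ≠ i₀ → b j l ≤ 0)) (al : Fin m → ℝ) (hl : ∀ j, ∃ l, l ≠ i₀ ∧ al j = b j l)
    {lo hi : ℝ} (hlo : 0 < lo) (hg : ∀ x ∈ Set.Icc lo hi, ∀ j, ∑ l, b j l * x ^ (e l) ≠ 0) :
    AntitoneOn (fun x : ℝ => ∑ j, al j / ∑ l, b j l * x ^ (e l)) (Set.Icc lo hi) := by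
  have hder : ∀ x ∈ Set.Icc lo hi, ∃ D : ℝ, D ≤ 0 ∧ HasDerivAt (fun t : ℝ => ∑ j, al j / ∑ l, b j l * t ^ (e l)) D x := by
    intro x hx
    have hx0 : 0 < x := hlo.trans_le hx.1
    refine ⟨_, ?_, HasDerivAt.fun_sum (u := Finset.univ) fun j _ => letterTermK_hasDerivAt e (b j) (al j) (hg x hx j)⟩
    refine Finset.sum_nonpos fun j _ => ?_
    have hnum := letterTermK_deriv_sign e (b j) i₀ he (hus j) (al j) (hl j) hx0
    have hden : 0 < (∑ l, b j l * x ^ (e l)) ^ 2 := by have := hg x hx j; positivity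
    exact div_nonpos_of_nonpos_of_nonneg (neg_nonpos.2 hnum) hden.le
  have hcont : ContinuousOn (fun x : ℝ => ∑ j, al j / ∑ l, b j l * x ^ (e l)) (Set.Icc lo hi) := fun x hx => by
    obtain ⟨D, _, hD⟩ := hder x hx
    exact hD.continuousAt.continuousWithinAt
  refine antitoneOn_of_deriv_nonpos (convex_Icc lo hi) hcont ?_ ?_
  · intro x hx
    rw [interior_Icc] at hx
    obtain ⟨D, _, hD⟩ := hder x (Set.Ioo_subset_Icc_self hx)
    exact hD.differentiableAt.differentiableWithinAt
  · intro x hx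
    rw [interior_Icc] at hx
    obtain ⟨D, hD0, hD⟩ := hder x (Set.Ioo_subset_Icc_self hx)
    rw [hD.deriv]; exact hD0

/-! ### §3 Every K, bottom coupling: a zero needs two stripped letter sums of opposite sign -/

/-- Factor through the stripped factor: `f_j(x) = x^{d_0}·g_j(x)` with `g_j(x) = Σ_l a_{jl} x^{d_l − d_0}` (`d` monotone from index `0`). -/
theorem eval_factor_eq_pow_mul_stripped {K : ℕ} (d : Fin K → ℕ) (i₀ : Fin K) (hd : ∀ l, d i₀ ≤ d l) (b : Fin K → ℝ) (x : ℝ) :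
    (∑ l, C (b l) * X ^ (d l) : ℝ[X]).eval x = x ^ (d i₀) * ∑ l, b l * x ^ (d l - d i₀) := by
  rw [eval_finsetSum, Finset.mul_sum]
  refine Finset.sum_congr rfl fun l _ => ?_
  rw [eval_mul, eval_C, eval_pow, eval_X]
  have : x ^ (d l) = x ^ (d i₀) * x ^ (d l - d i₀) := by rw [← pow_add, Nat.add_sub_cancel' (hd l)]
  rw [this]; ring

/-- **Every K, bottom coupling `l₀ = i₀` with `d` minimal there and strictly larger elsewhere**: at a pole-free `x > 0` where ALL stripped
letter sums `A_l(x) = Σ_j a_{jl}/g_j(x)`, `l ≠ i₀`, are positive, `R(x) > 0`-or-`< 0` according to `∏ f_j(x)`, in particular `R(x) ≠ 0`;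
likewise if all are negative.  (Zeros of `R` need two letter sums of opposite sign.) [this file's theorem] -/
theorem eulerNumerator_eval_ne_zero_of_letterSumsK {m K : ℕ} (d : Fin K → ℕ) (i₀ : Fin K) (hd : ∀ l, l ≠ i₀ → d i₀ < d l)
    (hK : ∃ l : Fin K, l ≠ i₀) (a : Fin m → Fin K → ℝ) {x : ℝ} (hx : 0 < x)
    (hf : ∀ j, (∑ l, C (a j l) * X ^ (d l) : ℝ[X]).eval x ≠ 0)
    (hsign : (∀ l, l ≠ i₀ → 0 < ∑ j, a j l / ∑ l', a j l' * x ^ (d l' - d i₀)) ∨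
             (∀ l, l ≠ i₀ → ∑ j, a j l / ∑ l', a j l' * x ^ (d l' - d i₀) < 0)) :
    (∑ j, (∑ l, C (a j l * ((d l : ℝ) - d i₀)) * X ^ (d l)) * ∏ i ∈ Finset.univ.erase j, (∑ l, C (a i l) * X ^ (d l))
        : ℝ[X]).eval x ≠ 0 := by
  classical
  have hd' : ∀ l, d i₀ ≤ d l := fun l => by
    by_cases h : l = i₀
    · rw [h]
    · exact (hd l h).le
  rw [eval_eulerNumerator_eq_prod_mul_letterSumsK d a i₀ hf]
  refine mul_ne_zero (Finset.prod_ne_zero_iff.2 fun j _ => hf j) ?_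
  -- rewrite each `x^{d_l}·Σ_j a_{jl}/f_j(x)` as `x^{d_l − d_{i₀}}·A_l(x)` through the stripped factors
  have hstrip : ∀ l, x ^ (d l) * ∑ j, a j l / (∑ l', C (a j l') * X ^ (d l') : ℝ[X]).eval x
      = x ^ (d l - d i₀) * ∑ j, a j l / ∑ l', a j l' * x ^ (d l' - d i₀) := by
    intro l
    rw [Finset.mul_sum, Finset.mul_sum]
    refine Finset.sum_congr rfl fun j _ => ?_
    rw [eval_factor_eq_pow_mul_stripped d i₀ hd' (a j) x]
    have hxp : x ^ (d i₀) ≠ 0 := pow_ne_zero _ hx.ne'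
    have : x ^ (d l) = x ^ (d i₀) * x ^ (d l - d i₀) := by rw [← pow_add, Nat.add_sub_cancel' (hd' l)]
    rw [this]
    field_simp
  have hterm : ∀ l, ((d l : ℝ) - d i₀) * x ^ (d l) * ∑ j, a j l / (∑ l', C (a j l') * X ^ (d l') : ℝ[X]).eval x
      = ((d l : ℝ) - d i₀) * (x ^ (d l - d i₀) * ∑ j, a j l / ∑ l', a j l' * x ^ (d l' - d i₀)) := by
    intro l; rw [mul_assoc, hstrip l]
  simp_rw [hterm]
  -- the `i₀` term vanishes; every other term has the strict sign of `hsign`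
  obtain ⟨l₁, hl₁⟩ := hK
  have hcoef : ∀ l, l ≠ i₀ → 0 < ((d l : ℝ) - d i₀) * x ^ (d l - d i₀) := by
    intro l hl
    have : (d i₀ : ℝ) < d l := by exact_mod_cast hd l hl
    have hxp : 0 < x ^ (d l - d i₀) := pow_pos hx _
    nlinarith
  rcases hsign with hpos | hneg
  · apply ne_of_gt
    rw [← Finset.sum_erase_add _ _ (Finset.mem_univ i₀)]
    have h0 : ((d i₀ : ℝ) - d i₀) * (x ^ (d i₀ - d i₀) * ∑ j, a j i₀ / ∑ l', a j l' * x ^ (d l' - d i₀)) = 0 := by ring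
    rw [h0, add_zero]
    refine Finset.sum_pos (fun l hl => ?_) ⟨l₁, Finset.mem_erase.2 ⟨hl₁, Finset.mem_univ _⟩⟩
    have hl' : l ≠ i₀ := Finset.ne_of_mem_erase hl
    have := mul_pos (hcoef l hl') (hpos l hl')
    linarith [this]
  · apply ne_of_lt
    rw [← Finset.sum_erase_add _ _ (Finset.mem_univ i₀)]
    have h0 : ((d i₀ : ℝ) - d i₀) * (x ^ (d i₀ - d i₀) * ∑ j, a j i₀ / ∑ l', a j l' * x ^ (d l' - d i₀)) = 0 := by ring
    rw [h0, add_zero]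
    refine Finset.sum_neg (fun l hl => ?_) ⟨l₁, Finset.mem_erase.2 ⟨hl₁, Finset.mem_univ _⟩⟩
    have hl' : l ≠ i₀ := Finset.ne_of_mem_erase hl
    have := mul_neg_of_pos_of_neg (hcoef l hl') (hneg l hl')
    linarith [this]

end ProductPlusOne

end Summit.ValiantsHypothesis.ValiantsHypothesis.Theorems.LacunarySymmetroidMatrixDescartes
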